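import Summits.RiemannHypothesis.RiemannHypothesis.Theorems.Splittings.ScrewBridgeRungs
import Summits.RiemannHypothesis.RiemannHypothesis.Theorems.Splittings.ScrewOrbitIndexBound
import HarnessLib

/-!
# Splittings — SCREW BRIDGE WEAK TAIL (screw bridge gen 4 §1–§5): FOZ ⟹ finitely many NEGATIVE pivots (unconditional), the weak ∃-tail,
# and Lemma U re-typed over quadruple representatives (SPLIT-screw-bridge §9; zero-definition raw form)

Cell rh-split, seat rh-split-screw-bridge g4 (brief sha16 f79c5f09d8bcb036); gen-4 addendum §9 of
`run/shared/lean/pub/rh-split/cards/SPLIT-screw-bridge.md`; source bytes `HOME/rh-split-screw-bridge/ScrewBridgeG4.lean`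
sha16 a87591dadf08210f (24 theorems, zero defs); referee rh-split-ref g2 replay + bytes PASS 2026-08-27T01:43:06Z
(«F1 a87591dadf08210f → ScrewBridgeWeakTail.lean»); filed by rh-split-typer-2 g3 on the lead's booking 01:43:05Z with a
NAMESPACE/HEADER-ONLY re-hash (this paragraph; namespace `…Splittings.ScrewBridgeWeakTail`; every declaration
byte-identical except that `quadRep_fibre` is deleted in favour of the landed identical `ScrewOrbitIndexBound.rep_fibre`, gate dedup; the companion §6 = tree `Splittings/ScrewBridgeRigidity.lean`).  Notation (written out everywhere, no definitions):
ETAIL = `∃ M₀, ∀ M ≥ M₀, 0 < screwPivot M`; WETAIL = `∃ M₀, ∀ M ≥ M₀, 0 ≤ screwPivot M` (the weak ∃-tail);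
FOZ = `CofiniteCriticalLine`; `n₋(n) = #{i | λ_i(screwMatrix n) < 0}`.

* §1 `negIndex_succ_eq_of_screwPivot_neg` — a NEGATIVE pivot `d_{n+2} < 0` forces both determinants non-zero and
  the negative index to increment (`n₋(n+1) = n₋(n) + 1`): sign rule + interlacing unit steps.
* §2 `card_negPivots_le` — under a uniform bound `n₋ ≤ K` at most `K` pivots are negative over the WHOLE ladder;
  `negPivots_finite_of_indexBound`, `wetail_of_indexBound`.
* §3 `wetail_of_foz` — **FOZ ⟹ WETAIL unconditionally** (R1 = tree `fozIndexBound`); `foz_negPivots_finite`;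
  `etail_iff_wetail_and_nonsingular` (the strict ∃-tail differs from the weak one exactly by the nonsingularity
  residual R2); `wetail_of_uniform_kiKimLee` (the printed uniform Ki–Kim–Lee door lands on WETAIL with NO residual);
  `etail_iff_nonposPivots_finite`.
* §4 fixed cut: `rh_iff_wtail512_and_detNonzero` — at the certified cut the tail factors as SIGN ∧ NON-DEGENERACY
  (determinant-axis precedent: screw-neg's `CostumeDetectorsScrewIII.rh_iff_detNonneg_and_detNonzero`).
* §5 Lemma U RE-TYPED over quadruple representatives (`½ < Re ρ ∧ 0 < Im ρ`): `indexTransfer_of_indexLowerBoundQuad`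
  (R3 follows from it), rung `indexLowerBoundQuad_of_card_le_one`.  (g3's typing over ALL off-line zeros asks `4q ≤ n₋`
  per `q` quadruples, which with the sharp bound `n₋ ≤ 2q` (PIVOT-LAW Lemma 1/Thm 3(i)) is `(FOZ → RH)`-strong.)

Everything here is RH-free linear algebra GIVEN the stated hypotheses; nothing bears on the truth of RH.

HONEST LABEL: SPLITTING SEARCH over kernel-typed RH-EQUIVALENCES; a splitting A ∧ B ⟹ RH is CONDITIONAL
bookkeeping unless A and B are both proved; nothing here bears on the truth of RH.
-/

set_option linter.dupNamespace false

noncomputable section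

namespace Summit.RiemannHypothesis.RiemannHypothesis.Theorems.Splittings.ScrewBridgeWeakTail

open Finset Matrix
open scoped ComplexConjugate
open Literature.NumberTheory.LFunctions
open Summit.RiemannHypothesis.RiemannHypothesis.Theses.RuelleBand
open Summit.RiemannHypothesis.RiemannHypothesis.Theorems.IntegerScrew
open Summit.RiemannHypothesis.RiemannHypothesis.Theorems.IntegerScrew.FozIndexBound
open Summit.RiemannHypothesis.RiemannHypothesis.Theorems.Splittings.BombieriFozNoDep
open Summit.RiemannHypothesis.RiemannHypothesis.Theorems.Splittings.ScrewBridgeRaw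
open Summit.RiemannHypothesis.RiemannHypothesis.Theorems.Splittings.ScrewBridgeRawG3
open Summit.RiemannHypothesis.RiemannHypothesis.Theorems.Splittings.ScrewBridgeFozConsequences
open Summit.RiemannHypothesis.RiemannHypothesis.Theorems.Splittings.ScrewBridgeRungs
open Summit.RiemannHypothesis.Cruxes.CofiniteCriticalLine.Negative

/-! ## §1 A negative pivot is an index increment -/

/-- The junk levels: `screwPivot 0 = screwPivot 1 = 1` (empty determinants). [folklore] -/
theorem screwPivot_of_lt_two {M : ℕ} (hM : M < 2) : screwPivot M = 1 := by
  interval_cases M <;> simp [screwPivot, screwDet, Matrix.det_isEmpty]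

/-- **A negative pivot `d_{n+2} < 0` forces both determinants `det S_{n+1}, det S_{n+2}` non-zero and the negative
index to INCREMENT, `n₋(n+1) = n₋(n) + 1`** (sign rule `screwPivot_pos_iff_even_iff_even` + interlacing unit steps
`negIndex_mono`, `negIndex_succ_le`). [folklore] -/
theorem negIndex_succ_eq_of_screwPivot_neg (n : ℕ) (h : screwPivot (n + 2) < 0) :
    screwDet n ≠ 0 ∧ screwDet (n + 1) ≠ 0 ∧
      (univ.filter fun i => (screwMatrix_isHermitian (n + 1)).eigenvalues i < 0).card =
        (univ.filter fun i => (screwMatrix_isHermitian n).eigenvalues i < 0).card + 1 := by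
  have hne : screwDet (n + 1) ≠ 0 ∧ screwDet n ≠ 0 := by
    rw [screwPivot_add_two] at h
    exact div_ne_zero_iff.mp h.ne
  refine ⟨hne.2, hne.1, ?_⟩
  have hpar := screwPivot_pos_iff_even_iff_even n (eigenvalues_ne_zero_of_screwDet_ne_zero hne.2)
    (eigenvalues_ne_zero_of_screwDet_ne_zero hne.1)
  have hnot : ¬ (Even ((univ.filter fun i => (screwMatrix_isHermitian (n + 1)).eigenvalues i < 0).card) ↔
      Even ((univ.filter fun i => (screwMatrix_isHermitian n).eigenvalues i < 0).card)) := by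
    rw [← hpar]; exact not_lt.mpr h.le
  have h1 : (univ.filter fun i => (screwMatrix_isHermitian n).eigenvalues i < 0).card ≤
      (univ.filter fun i => (screwMatrix_isHermitian (n + 1)).eigenvalues i < 0).card :=
    negIndex_mono (Nat.le_succ n)
  have h2 : (univ.filter fun i => (screwMatrix_isHermitian (n + 1)).eigenvalues i < 0).card ≤
      (univ.filter fun i => (screwMatrix_isHermitian n).eigenvalues i < 0).card + 1 :=
    negIndex_succ_le n
  rcases Nat.eq_or_lt_of_le h1 with heq | hlt
  · exact absurd (by rw [heq]) hnot
  · exact le_antisymm h2 hlt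

/-! ## §2 Counting negative pivots under a uniform index bound -/

/-- **Under a uniform bound `n₋ ≤ K` at most `K` pivots are negative over the whole ladder**: on the set of
negative-pivot indices `M ↦ n₋(M−1)` is strictly increasing with values in `[1, K]`. [folklore] -/
theorem card_negPivots_le {K : ℕ}
    (hK : ∀ n : ℕ, (univ.filter fun i => (screwMatrix_isHermitian n).eigenvalues i < 0).card ≤ K)
    (T : Finset ℕ) (hT : ∀ M ∈ T, screwPivot M < 0) : T.card ≤ K := by
  have hM2 : ∀ M ∈ T, 2 ≤ M := by
    intro M hM
    by_contra hlt
    have := screwPivot_of_lt_two (not_le.mp hlt)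
    linarith [hT M hM]
  let f : ℕ → ℕ := fun M => (univ.filter fun i => (screwMatrix_isHermitian (M - 1)).eigenvalues i < 0).card
  have hstep : ∀ M ∈ T,
      f M = (univ.filter fun i => (screwMatrix_isHermitian (M - 2)).eigenvalues i < 0).card + 1 := by
    intro M hM
    obtain ⟨m, rfl⟩ : ∃ m, M = m + 2 := ⟨M - 2, by have := hM2 M hM; omega⟩
    simp only [f]
    exact (negIndex_succ_eq_of_screwPivot_neg m (hT _ hM)).2.2
  have hlt : ∀ M ∈ T, ∀ M' ∈ T, M < M' → f M < f M' := by
    intro M hM M' hM' hMM'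
    have hmono := negIndex_mono (show M - 1 ≤ M' - 2 by have := hM2 M hM; omega)
    rw [hstep M' hM']
    exact Nat.lt_succ_of_le hmono
  have hinj : Set.InjOn f T := by
    intro M hM M' hM' hff
    by_contra hne
    rcases lt_or_gt_of_ne hne with h | h
    · exact absurd hff (hlt M hM M' hM' h).ne
    · exact absurd hff.symm (hlt M' hM' M hM h).ne
  have hrange : ∀ M ∈ T, f M ∈ Finset.Icc 1 K := by
    intro M hM
    rw [Finset.mem_Icc]
    exact ⟨by rw [hstep M hM]; omega, hK _⟩
  calc T.card ≤ (Finset.Icc 1 K).card := Finset.card_le_card_of_injOn f (fun a ha => hrange a ha) hinj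
    _ = K := by simp

/-- Hence **the set of negative-pivot indices is FINITE under a uniform index bound**. [folklore] -/
theorem negPivots_finite_of_indexBound
    (hK : ∃ K : ℕ, ∀ n : ℕ, (univ.filter fun i => (screwMatrix_isHermitian n).eigenvalues i < 0).card ≤ K) :
    {M : ℕ | screwPivot M < 0}.Finite := by
  obtain ⟨K, hK⟩ := hK
  by_contra hinf
  obtain ⟨T, hTsub, hTcard⟩ := Set.Infinite.exists_subset_card_eq hinf (K + 1)
  have := card_negPivots_le hK T (fun M hM => hTsub (Finset.mem_coe.mpr hM))
  omega

/-- **Weak ∃-tail from a bounded index**: eventually `0 ≤ d_M` (no nonsingularity needed — a singular level gives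
`d = 0` by a genuine zero determinant or by the junk value `x / 0 = 0`). [folklore] -/
theorem wetail_of_indexBound
    (hK : ∃ K : ℕ, ∀ n : ℕ, (univ.filter fun i => (screwMatrix_isHermitian n).eigenvalues i < 0).card ≤ K) :
    ∃ M₀ : ℕ, ∀ M : ℕ, M₀ ≤ M → 0 ≤ screwPivot M := by
  obtain ⟨B, hB⟩ := (negPivots_finite_of_indexBound hK).bddAbove
  refine ⟨B + 1, fun M hM => not_lt.mp fun hneg => ?_⟩
  have := hB hneg
  omega

/-- ETAIL is «only finitely many non-positive pivots». [folklore] -/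
theorem etail_iff_nonposPivots_finite :
    (∃ M₀ : ℕ, ∀ M : ℕ, M₀ ≤ M → 0 < screwPivot M) ↔ {M : ℕ | screwPivot M ≤ 0}.Finite := by
  constructor
  · rintro ⟨M₀, hM₀⟩
    refine (Set.finite_Iio M₀).subset fun M hM => ?_
    by_contra h'
    exact absurd (hM₀ M (not_lt.mp h')) (not_lt.mpr hM)
  · intro hfin
    obtain ⟨B, hB⟩ := hfin.bddAbove
    refine ⟨B + 1, fun M hM => not_le.mp fun hnp => ?_⟩
    have := hB hnp
    omega

/-! ## §3 FOZ ⟹ finitely many negative pivots ⟹ WETAIL (unconditional); doors -/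

/-- **FOZ ⟹ at most `K` negative pivots over the whole ladder** (R1 `fozIndexBound` + §2). [folklore] -/
theorem foz_card_negPivots_le (hfoz : CofiniteCriticalLine) :
    ∃ K : ℕ, ∀ T : Finset ℕ, (∀ M ∈ T, screwPivot M < 0) → T.card ≤ K := by
  obtain ⟨K, hK⟩ := fozIndexBound hfoz
  exact ⟨K, fun T hT => card_negPivots_le hK T hT⟩

/-- **FOZ ⟹ the negative pivots form a finite set.** [folklore] -/
theorem foz_negPivots_finite (hfoz : CofiniteCriticalLine) : {M : ℕ | screwPivot M < 0}.Finite :=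
  negPivots_finite_of_indexBound (fozIndexBound hfoz)

/-- **FOZ ⟹ WETAIL, unconditionally**: finitely many off-line zeros force the screw pivots to be eventually
NON-NEGATIVE.  (The strict ∃-tail needs in addition exactly the nonsingularity residual R2,
`etail_iff_wetail_and_nonsingular`.) [folklore] -/
theorem wetail_of_foz (hfoz : CofiniteCriticalLine) : ∃ M₀ : ℕ, ∀ M : ℕ, M₀ ≤ M → 0 ≤ screwPivot M :=
  wetail_of_indexBound (fozIndexBound hfoz)

/-- RH ⟹ WETAIL (trivially, via the strict tail). [folklore] -/
theorem wetail_of_rh (h : _root_.RiemannHypothesis) : ∃ M₀ : ℕ, ∀ M : ℕ, M₀ ≤ M → 0 ≤ screwPivot M :=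
  (etailScrew_of_rh h).imp fun _ hM₀ M hM => (hM₀ M hM).le

/-- **ETAIL ⟺ WETAIL ∧ (eventually nonsingular)**: the strict and the weak ∃-tails differ exactly by the
non-degeneracy of the screw matrices. [folklore] -/
theorem etail_iff_wetail_and_nonsingular :
    (∃ M₀ : ℕ, ∀ M : ℕ, M₀ ≤ M → 0 < screwPivot M) ↔
      (∃ M₀ : ℕ, ∀ M : ℕ, M₀ ≤ M → 0 ≤ screwPivot M) ∧ (∃ N : ℕ, ∀ n : ℕ, N ≤ n → screwDet n ≠ 0) := by
  constructor
  · intro h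
    exact ⟨h.imp fun _ hM₀ M hM => (hM₀ M hM).le, etail_eventuallyNonsingular h⟩
  · rintro ⟨⟨M₀, hM₀⟩, ⟨N, hN⟩⟩
    refine ⟨max M₀ (N + 2), fun M hM => ?_⟩
    obtain ⟨m, rfl⟩ : ∃ m, M = m + 2 := ⟨M - 2, by have := le_of_max_le_right hM; omega⟩
    have h0 := hM₀ (m + 2) (le_of_max_le_left hM)
    rw [screwPivot_add_two] at h0 ⊢
    have ha : screwDet (m + 1) ≠ 0 := hN _ (by have := le_of_max_le_right hM; omega)
    have hb : screwDet m ≠ 0 := hN _ (by have := le_of_max_le_right hM; omega)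
    exact lt_of_le_of_ne h0 (div_ne_zero ha hb).symm

/-- Under FOZ: ETAIL ⟺ eventually nonsingular (the weak half being a theorem). [folklore] -/
theorem foz_etail_iff_nonsingular (hfoz : CofiniteCriticalLine) :
    (∃ M₀ : ℕ, ∀ M : ℕ, M₀ ≤ M → 0 < screwPivot M) ↔ (∃ N : ℕ, ∀ n : ℕ, N ≤ n → screwDet n ≠ 0) := by
  rw [etail_iff_wetail_and_nonsingular]
  exact ⟨fun h => h.2, fun h => ⟨wetail_of_foz hfoz, h⟩⟩

/-- **The printed uniform Ki–Kim–Lee door lands on the WEAK screw ∃-tail with NO residual**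
(`cofiniteCriticalLine_iff_kiKimLee_at_zero`, `kiKimLee_at_zero_of_uniform`, `wetail_of_foz`).
[cite: KiKimLee2009, Thm. 1.3] -/
theorem wetail_of_uniform_kiKimLee {T δ : ℝ} (hδ : 0 < δ)
    (h : ∀ t : ℝ, 0 < t → t < δ → ∀ z : ℂ, deBruijnH t z = 0 → T ≤ |z.re| → z.im = 0) :
    ∃ M₀ : ℕ, ∀ M : ℕ, M₀ ≤ M → 0 ≤ screwPivot M :=
  wetail_of_foz (cofiniteCriticalLine_iff_kiKimLee_at_zero.2 ⟨T + 1, kiKimLee_at_zero_of_uniform hδ h⟩)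

/-- The weak ∃-tail sits between RH and nothing typed so far: `RH ⟹ FOZ ⟹ WETAIL`, both arrows theorems.
[folklore] -/
theorem rh_imp_foz_imp_wetail :
    (_root_.RiemannHypothesis → CofiniteCriticalLine) ∧
      (CofiniteCriticalLine → ∃ M₀ : ℕ, ∀ M : ℕ, M₀ ≤ M → 0 ≤ screwPivot M) :=
  ⟨cofiniteCriticalLine_of_rh, wetail_of_foz⟩

/-! ## §4 Fixed cut: the tail factors as SIGN ∧ NON-DEGENERACY -/

/-- **`RH ⟺ WTAIL(512) ∧ NS`**: with every screw determinant non-zero, NON-NEGATIVE pivots beyond the certified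
cut `H = 512` already give RH (`riemannHypothesis_iff_screwPivot_pos_ge_513`); both conjuncts are RH-implied.
Determinant-axis precedent: `CostumeDetectorsScrewIII.rh_iff_detNonneg_and_detNonzero` (screw-neg). [folklore] -/
theorem rh_iff_wtail512_and_detNonzero :
    _root_.RiemannHypothesis ↔ (∀ M : ℕ, 512 < M → 0 ≤ screwPivot M) ∧ (∀ n : ℕ, screwDet n ≠ 0) := by
  constructor
  · intro h
    exact ⟨fun M hM => (riemannHypothesis_iff_screwPivot_pos.mp h M (by omega)).le,
      fun n => (screwDet_pos_of_posDef (screwMatrix_posDef_of_riemannHypothesis h n)).ne'⟩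
  · rintro ⟨hw, hns⟩
    refine riemannHypothesis_iff_screwPivot_pos_ge_513.mpr fun M hM => ?_
    obtain ⟨m, rfl⟩ : ∃ m, M = m + 2 := ⟨M - 2, by omega⟩
    have h0 := hw (m + 2) (by omega)
    rw [screwPivot_add_two] at h0 ⊢
    exact lt_of_le_of_ne h0 (div_ne_zero (hns _) (hns _)).symm

/-- Given NS (all screw determinants non-zero), the weak tail at the certified cut IS RH. [folklore] -/
theorem wtail512_iff_rh_of_detNonzero (hns : ∀ n : ℕ, screwDet n ≠ 0) :
    (∀ M : ℕ, 512 < M → 0 ≤ screwPivot M) ↔ _root_.RiemannHypothesis :=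
  ⟨fun hw => rh_iff_wtail512_and_detNonzero.mpr ⟨hw, hns⟩, fun h => (rh_iff_wtail512_and_detNonzero.mp h).1⟩

/-! ## §5 Lemma U re-typed over quadruple representatives; R3 from it; the first rung -/

/-- A zero in the open quadrant `½ < Re ρ` refutes RH. [folklore] -/
theorem not_rh_of_re_gt_half (ρ : ZetaZeros.riemannZetaNontrivialZeros) (hρ : 1 / 2 < (ρ : ℂ).re) :
    ¬ _root_.RiemannHypothesis := by
  intro hRH
  obtain ⟨hz, h0, h1⟩ := ZetaZeros.riemannZetaNontrivialZeros.mem_iff'.1 ρ.2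
  have : (ρ : ℂ).re = 1 / 2 := by
    refine hRH (ρ : ℂ) hz ?_ ?_
    · rintro ⟨k, hk⟩
      have hre : (ρ : ℂ).re = -2 * ((k : ℝ) + 1) := by rw [hk]; simp
      have hk0 : (0 : ℝ) ≤ k := Nat.cast_nonneg k
      linarith
    · intro h1eq
      rw [h1eq, Complex.one_re] at h1
      exact lt_irrefl _ h1
  linarith

-- `quadRep_fibre` of the seat's scratch is the landed `ScrewOrbitIndexBound.rep_fibre` (same statement); cited, not
-- re-declared (gate dedup).

/-- The quadrant representative of an OFF-LINE non-trivial zero is a non-trivial zero in the open quadrant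
`½ < Re, 0 < Im` (`conj_mem`, `one_sub_conj_mem`, `im_ne_zero`). [folklore] -/
theorem quadRep_mem {s : ℂ} (hs : s ∈ ZetaZeros.riemannZetaNontrivialZeros) (hoff : s.re ≠ 1 / 2) :
    (⟨max s.re (1 - s.re), |s.im|⟩ : ℂ) ∈ ZetaZeros.riemannZetaNontrivialZeros ∧
      1 / 2 < (⟨max s.re (1 - s.re), |s.im|⟩ : ℂ).re ∧ 0 < (⟨max s.re (1 - s.re), |s.im|⟩ : ℂ).im := by
  refine ⟨?_, ?_, ?_⟩
  · rcases max_choice s.re (1 - s.re) with hm | hm <;> rcases abs_choice s.im with ha | ha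
    · have : (⟨max s.re (1 - s.re), |s.im|⟩ : ℂ) = s := by
        apply Complex.ext <;> simp [hm, ha]
      rw [this]; exact hs
    · have : (⟨max s.re (1 - s.re), |s.im|⟩ : ℂ) = conj s := by
        apply Complex.ext <;> simp [hm, ha]
      rw [this]; exact ZetaZeros.riemannZetaNontrivialZeros.conj_mem hs
    · have : (⟨max s.re (1 - s.re), |s.im|⟩ : ℂ) = 1 - conj s := by
        apply Complex.ext <;> simp [hm, ha]
      rw [this]; exact ZetaZeros.riemannZetaNontrivialZeros.one_sub_conj_mem hs
    · have : (⟨max s.re (1 - s.re), |s.im|⟩ : ℂ) = 1 - conj (conj s) := by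
        apply Complex.ext <;> simp [hm, ha]
      rw [this]
      exact ZetaZeros.riemannZetaNontrivialZeros.one_sub_conj_mem
        (ZetaZeros.riemannZetaNontrivialZeros.conj_mem hs)
  · show 1 / 2 < max s.re (1 - s.re)
    rcases lt_or_gt_of_ne hoff with hlt | hgt
    · exact lt_max_of_lt_right (by linarith)
    · exact lt_max_of_lt_left hgt
  · show 0 < |s.im|
    exact abs_pos.mpr (ZetaZeros.riemannZetaNontrivialZeros.im_ne_zero hs)

/-- **Infinitely many off-line zeros give infinitely many zeros in the open quadrant** (each Klein orbit has a
representative there and at most four members). [folklore] -/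
theorem quadrant_infinite_of_not_foz (h : ¬ CofiniteCriticalLine) :
    ({ρ | 1 / 2 < (ρ : ℂ).re ∧ 0 < (ρ : ℂ).im} : Set ZetaZeros.riemannZetaNontrivialZeros).Infinite := by
  intro hQ
  apply h
  have himg := hQ.image (Subtype.val : ZetaZeros.riemannZetaNontrivialZeros → ℂ)
  have hpre := himg.preimage' (f := fun s : ℂ => (⟨max s.re (1 - s.re), |s.im|⟩ : ℂ)) fun b _ => by
    refine (Finset.finite_toSet ({b, conj b, 1 - conj b, 1 - b} : Finset ℂ)).subset fun s hs => ?_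
    simp only [Finset.coe_insert, Finset.coe_singleton, Set.mem_insert_iff, Set.mem_singleton_iff]
    exact Summit.RiemannHypothesis.RiemannHypothesis.Theorems.Splittings.ScrewOrbitIndexBound.rep_fibre hs
  refine hpre.subset fun s hs => ?_
  obtain ⟨hz, h0, h1, hoff⟩ := hs
  have hmem : s ∈ ZetaZeros.riemannZetaNontrivialZeros :=
    ZetaZeros.riemannZetaNontrivialZeros.mem_iff'.2 ⟨hz, h0, h1⟩
  obtain ⟨hm, hr, hi⟩ := quadRep_mem hmem hoff
  exact ⟨⟨_, hm⟩, ⟨hr, hi⟩, rfl⟩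

/-- **Lemma U re-typed ⟹ R3**: if every finite set of zeros in the OPEN QUADRANT `½ < Re ρ ∧ 0 < Im ρ` (one
representative per off-line quadruple) is eventually matched by as many negative eigenvalues, then a bounded
negative index forces FOZ (`IndexTransfer`).  This is the RH-free typing of PIVOT-LAW Lemma U; the typing over
ALL off-line zeros (g3 `indexTransfer_of_indexLowerBound`) over-counts each quadruple four times. [folklore] -/
theorem indexTransfer_of_indexLowerBoundQuad
    (hU : ∀ F : Finset ZetaZeros.riemannZetaNontrivialZeros,
      (∀ ρ ∈ F, 1 / 2 < (ρ : ℂ).re ∧ 0 < (ρ : ℂ).im) →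
        ∃ N : ℕ, ∀ n : ℕ, N ≤ n →
          F.card ≤ (Finset.univ.filter fun i => (screwMatrix_isHermitian n).eigenvalues i < 0).card) :
    (∃ K : ℕ, ∀ n : ℕ, (Finset.univ.filter fun i => (screwMatrix_isHermitian n).eigenvalues i < 0).card ≤ K) →
      CofiniteCriticalLine := by
  rintro ⟨K, hK⟩
  by_contra hS
  obtain ⟨F, hFsub, hFcard⟩ := (quadrant_infinite_of_not_foz hS).exists_subset_card_eq (K + 1)
  obtain ⟨N, hN⟩ := hU F fun ρ hρ => hFsub (Finset.mem_coe.mpr hρ)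
  have h1 := hN N le_rfl
  have h2 := hK N
  omega

/-- With the re-typed Lemma U, `ETAIL ⟺ FOZ` holds modulo R2 alone. [folklore] -/
theorem etail_iff_foz_of_indexLowerBoundQuad
    (hU : ∀ F : Finset ZetaZeros.riemannZetaNontrivialZeros,
      (∀ ρ ∈ F, 1 / 2 < (ρ : ℂ).re ∧ 0 < (ρ : ℂ).im) →
        ∃ N : ℕ, ∀ n : ℕ, N ≤ n →
          F.card ≤ (Finset.univ.filter fun i => (screwMatrix_isHermitian n).eigenvalues i < 0).card)
    (h2 : CofiniteCriticalLine → (∃ N : ℕ, ∀ n : ℕ, N ≤ n → screwDet n ≠ 0)) :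
    (∃ M₀ : ℕ, ∀ M : ℕ, M₀ ≤ M → 0 < screwPivot M) ↔ CofiniteCriticalLine :=
  etail_iff_foz_of (indexTransfer_of_indexLowerBoundQuad hU) h2

/-- **Rung of the re-typed Lemma U: at most one representative** (`#F ≤ 1`) — a zero in the quadrant refutes RH,
and off RH the negative index is eventually `≥ 1`. [folklore] -/
theorem indexLowerBoundQuad_of_card_le_one (F : Finset ZetaZeros.riemannZetaNontrivialZeros)
    (hF : ∀ ρ ∈ F, 1 / 2 < (ρ : ℂ).re ∧ 0 < (ρ : ℂ).im) (h1 : F.card ≤ 1) :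
    ∃ N : ℕ, ∀ n : ℕ, N ≤ n →
      F.card ≤ (Finset.univ.filter fun i => (screwMatrix_isHermitian n).eigenvalues i < 0).card := by
  by_cases h0 : F.card = 0
  · exact ⟨0, fun n _ => by rw [h0]; exact Nat.zero_le _⟩
  · have hc : F.card = 1 := by omega
    obtain ⟨ρ, hρF⟩ := Finset.card_pos.mp (by omega : 0 < F.card)
    obtain ⟨N, hN⟩ := one_le_negIndex_eventually_of_not_rh (not_rh_of_re_gt_half ρ (hF ρ hρF).1)
    exact ⟨N, fun n hn => hc ▸ hN n hn⟩

/-- Under RH the re-typed Lemma U holds vacuously (no zero in the quadrant). [folklore] -/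
theorem indexLowerBoundQuad_of_rh (h : _root_.RiemannHypothesis) (F : Finset ZetaZeros.riemannZetaNontrivialZeros)
    (hF : ∀ ρ ∈ F, 1 / 2 < (ρ : ℂ).re ∧ 0 < (ρ : ℂ).im) :
    ∃ N : ℕ, ∀ n : ℕ, N ≤ n →
      F.card ≤ (Finset.univ.filter fun i => (screwMatrix_isHermitian n).eigenvalues i < 0).card := by
  have hF0 : F = ∅ := by
    by_contra hne
    obtain ⟨ρ, hρ⟩ := Finset.nonempty_iff_ne_empty.mpr hne
    exact not_rh_of_re_gt_half ρ (hF ρ hρ).1 h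
  subst hF0
  exact ⟨0, fun n _ => by simp⟩

end Summit.RiemannHypothesis.RiemannHypothesis.Theorems.Splittings.ScrewBridgeWeakTail

end
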